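/-
Copyright: the b2b-balaban T⁴-continuum CRUX team, row NE7b leaf lineage `t4-ne7b-formalise-leaf-05` (gen 157). Project licence.
-/
import Literature.MathematicalPhysics.QuantumFieldTheory.Balaban1983to89.B14TentUnityTorus

/-!
# THE STEP LETTER OF PRINT's TENT ON THE DISCRETE CIRCLE: `|h(u + 1) − h(u)| ≤ 1∕L` for `h = B14TentUnityTorus.tentZ L` ([Balaban1988Convergent] (3.40) p. 275,
# kernel home `B14TentUnity(Torus)`) — the Lipschitz input of the (h2) partition supplier (`…TentPartitionProduct` ∕ `…TentPartitionPath` ∕ `…QuadraticPartitionOfUnity`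
# ∕ `…AdmissibleFloorLinearPartition`) read on the tree's CITED tent rather than on a new one (row NE7b, node U5c; residual (R2′) family (2), letter (ℓ1); kernel lemmas)

Cell `pub-balaban`, sub-cell `t4`, spine estimate NE7b (`T4WeightBudget.RelWeightBound`; the cell's OWN estimate — NOT PRINTED in [Bałaban 1983–89],
NOT PROVED).  Crux-route work under `Spine/NE7b/`; NOTHING of Bałaban's is asserted beyond what `B14TentUnityTorus` cites; no `def`; zero `sorry`; no
`T4Continuum/Support` leaf (FREEZE (0)).  Import: `Literature.….B14TentUnityTorus` (hub olean present): `tentZ L u = B14Sect3.tent L (valMinAbs u)`,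
`B14Sect3.tent L t = max (1 − |t|∕L) 0`.

WHY.  Chair X-TPC (leaf-04 g159, δ-X-TPC-1) located the tree's cited home of print's tent partition; `…TentPartitionChain` (this gen) carries the STEP letters in
a `ZMod`-free block×offset model.  THIS FILE proves the step letter directly for the CITED object on `ZMod N`, so that the torus instance of the (h2) partition
supplier can be built on `tentZ`∕`tentT` (route (ii) of `g157/H2-CURRENCY-JUNCTION-g157.md` §6) without a seventh `tent`.

WHAT IS PROVED ([folklore]):
* §1 `abs_tent_sub_tent_le` — the real tent is `1∕L`-Lipschitz in `|t|`: `|tent L t − tent L t′| ≤ ||t| − |t′||∕L ≤ |t − t′|∕L` (`abs_max_sub_max_le_abs`).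
* §2 `natAbs_valMinAbs_add_one` — on `ZMod N`, `2 ≤ N`: the circle distance to `0` moves by at most one under `u ↦ u + 1`:
  `|(|valMinAbs (u+1)| : ℤ) − |valMinAbs u|| ≤ 1` (`valMinAbs_natAbs_eq_min` + `val_add`, `omega`).
* §3 **`abs_tentZ_add_one_sub_le`** — `|tentZ L (u + 1) − tentZ L u| ≤ 1∕L` (`0 < L`, `2 ≤ N`); `sq_tentZ_add_one_sub_le` (`≤ 1∕L²`).

NOT HERE (honest): the multiplicity letter on the torus (at most two coarse centres `z` with `tentZ L (x − Lz) ≠ 0`), the `d`-axis∕path∕normalisation steps (TPP ∕ TPA ∕ QPU,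
abstract — they take this file's letter as input), anything of Bałaban's estimates.  BY-NAME EFFECT ON THE WALL: NONE.  NE7b NOT PRINTED ∕ NOT PROVED; spine
PROVED 0∕9; rung (B)+1 on ONE finite T⁴ — NOT infinite volume, NOT the mass gap, NOT Clay.
HONEST DEPENDENCY: continuum YM on T⁴ ⇐ BetaPertH ∧ nine spine estimates (0/9 proved); BetaPertH ⇐ (D1) ∧ (D4) ∧ CAP+tail; G-an2-4 gates asym, D1 and NE2/3/4.
-/

set_option autoImplicit false

noncomputable section

open Literature.MathematicalPhysics.QuantumFieldTheory.Balaban1983to89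
open Literature.MathematicalPhysics.QuantumFieldTheory.Balaban1983to89.B14.TentUnityTorus (tentZ)

namespace Summit.QuantumFields.BalabanUV.T4Continuum.NE7b.TentUnityTorusSteps

/-! ## §1 The real tent is `1∕L`-Lipschitz in `|t|` -/

/-- `|tent L t − tent L t′| ≤ ||t| − |t′||∕L` for `0 < L` (`max(·, 0)` is 1-Lipschitz). [folklore] -/
theorem abs_tent_sub_tent_le {L : ℝ} (hL : 0 < L) (t t' : ℝ) :
    |B14Sect3.tent L t - B14Sect3.tent L t'| ≤ |(|t| - |t'|)| / L := by
  unfold B14Sect3.tent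
  refine (abs_max_sub_max_le_abs _ _ _).trans (le_of_eq ?_)
  rw [show (1 - |t| / L) - (1 - |t'| / L) = -((|t| - |t'|) / L) by ring, abs_neg, abs_div, abs_of_pos hL]

/-- … `≤ |t − t′|∕L`. [folklore] -/
theorem abs_tent_sub_tent_le' {L : ℝ} (hL : 0 < L) (t t' : ℝ) :
    |B14Sect3.tent L t - B14Sect3.tent L t'| ≤ |t - t'| / L :=
  (abs_tent_sub_tent_le hL t t').trans (div_le_div_of_nonneg_right (abs_abs_sub_abs_le_abs_sub t t') hL.le)

/-! ## §2 The circle distance to `0` moves by at most one under `u ↦ u + 1` -/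

/-- On `ZMod N` with `2 ≤ N`: `|(|valMinAbs (u+1)| : ℤ) − |valMinAbs u|| ≤ 1` (through `|valMinAbs u| = min (val u) (N − val u)` and `val (u+1) = (val u + 1) mod N`).
[folklore] -/
theorem natAbs_valMinAbs_add_one {N : ℕ} (hN : 2 ≤ N) (u : ZMod N) :
    |(((u + 1).valMinAbs.natAbs : ℕ) : ℤ) - ((u.valMinAbs.natAbs : ℕ) : ℤ)| ≤ 1 := by
  haveI : NeZero N := ⟨by omega⟩
  haveI : Fact (1 < N) := ⟨by omega⟩
  rw [ZMod.valMinAbs_natAbs_eq_min, ZMod.valMinAbs_natAbs_eq_min, ZMod.val_add, ZMod.val_one]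
  have hv := ZMod.val_lt u
  rcases Nat.lt_or_ge (u.val + 1) N with hlt | hge
  · rw [Nat.mod_eq_of_lt hlt]
    rw [abs_le]
    constructor <;> · push_cast [Nat.cast_min]; omega
  · have heq : u.val + 1 = N := by omega
    rw [heq, Nat.mod_self]
    rw [abs_le]
    constructor <;> · push_cast [Nat.cast_min]; omega

/-! ## §3 The step letter for the cited circle tent -/

/-- **`|tentZ L (u + 1) − tentZ L u| ≤ 1∕L`** for `0 < L`, `2 ≤ N` — print's tent (3.40) on the discrete circle moves by at most `1∕L` per lattice step. [folklore] -/
theorem abs_tentZ_add_one_sub_le {L : ℝ} (hL : 0 < L) {N : ℕ} (hN : 2 ≤ N) (u : ZMod N) :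
    |tentZ L (u + 1) - tentZ L u| ≤ 1 / L := by
  unfold tentZ
  refine (abs_tent_sub_tent_le hL _ _).trans ?_
  rw [div_le_div_iff_of_pos_right hL]
  have e1 : |(((u + 1).valMinAbs : ℤ) : ℝ)| = (((u + 1).valMinAbs.natAbs : ℕ) : ℝ) := by
    rw [← Int.cast_abs, Int.abs_eq_natAbs, Int.cast_natCast]
  have e2 : |((u.valMinAbs : ℤ) : ℝ)| = ((u.valMinAbs.natAbs : ℕ) : ℝ) := by
    rw [← Int.cast_abs, Int.abs_eq_natAbs, Int.cast_natCast]
  rw [e1, e2]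
  exact_mod_cast natAbs_valMinAbs_add_one hN u

/-- … and squared: `(tentZ L (u + 1) − tentZ L u)² ≤ 1∕L²`. [folklore] -/
theorem sq_tentZ_add_one_sub_le {L : ℝ} (hL : 0 < L) {N : ℕ} (hN : 2 ≤ N) (u : ZMod N) :
    (tentZ L (u + 1) - tentZ L u) ^ 2 ≤ 1 / L ^ 2 := by
  have h := abs_tentZ_add_one_sub_le hL hN u
  rw [← sq_abs, one_div, ← inv_pow, ← one_div]
  exact pow_le_pow_left₀ (abs_nonneg _) h 2

end Summit.QuantumFields.BalabanUV.T4Continuum.NE7b.TentUnityTorusSteps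

end
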